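import Mathlib
import Summits.Ventures.PercRepro2.PMK5Deg5LocusCnt

/-!
# THE MAXIMAL DEGENERATE FACES OF `K₆` — PART 2: THE NINETEEN CONFIGURATION COUNTS AND THE VANISHING OF THE
CRUX FUNCTIONAL AT THE CENTRE (blind cell PercRepro2, mine-2 g32)

For each maximal face `M` of the five classes (fourteen in all, `MX` of `PMK5Deg5LocusWit.lean`), the nineteen
counts `cntV M i = #{ω ⊆ M : tab i ω}` by one `decide +kernel` over the count tree (`2^|M|` leaves), and then
`KposV (cntV M) = KnegV (cntV M)` by arithmetic on the literals — so `Gc` vanishes at the centre of `M`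
(`gc15_centre_zero`) and on the whole face (`gc15_zero_of_centre`).  This part:
* `28285` = `K₆` minus {oa₂ a₂u a₂b a₂a₃} (11 edges; `KposV = KnegV = 286664912`)
* `30622` = `K₆` minus {oa₁ a₁u a₁b a₁a₃} (11 edges; `KposV = KnegV = 286664912`)
* `32117` = `K₆` minus {oa₂ ob a₂u ub} (11 edges; `KposV = KnegV = 15925248`)
* `32214` = `K₆` minus {oa₁ ob a₁u ub} (11 edges; `KposV = KnegV = 15925248`)
Standard axioms.
-/

namespace Summit.Ventures.PercRepro2

namespace Deg5

namespace Locus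

set_option maxHeartbeats 0 in
set_option maxRecDepth 100000 in
/-- The nineteen configuration counts of the maximal face `28285` (`K₆` minus {oa₂ a₂u a₂b a₂a₃}). -/
theorem cntV_28285 : ∀ i : Fin 19, cntV 28285 i = ![1024, 150, 62, 812, 0, 812, 0, 766, 0, 874, 0, 874, 0, 874, 0, 812, 0, 46, 62] i := by
  decide +kernel

/-- The maximal face `28285`: equal positive and negative monomial sums. -/
theorem zero_28285 : KposV (cntV 28285) = KnegV (cntV 28285) := by
  rw [funext cntV_28285]
  decide

set_option maxHeartbeats 0 in
set_option maxRecDepth 100000 in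
/-- The nineteen configuration counts of the maximal face `30622` (`K₆` minus {oa₁ a₁u a₁b a₁a₃}). -/
theorem cntV_30622 : ∀ i : Fin 19, cntV 30622 i = ![1024, 150, 62, 812, 0, 812, 0, 766, 0, 0, 874, 0, 874, 0, 874, 0, 812, 46, 62] i := by
  decide +kernel

/-- The maximal face `30622`: equal positive and negative monomial sums. -/
theorem zero_30622 : KposV (cntV 30622) = KnegV (cntV 30622) := by
  rw [funext cntV_30622]
  decide

set_option maxHeartbeats 0 in
set_option maxRecDepth 100000 in
/-- The nineteen configuration counts of the maximal face `32117` (`K₆` minus {oa₂ ob a₂u ub}). -/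
theorem cntV_32117 : ∀ i : Fin 19, cntV 32117 i = ![416, 64, 24, 174, 78, 224, 64, 186, 54, 192, 128, 282, 36, 256, 96, 222, 72, 12, 32] i := by
  decide +kernel

/-- The maximal face `32117`: equal positive and negative monomial sums. -/
theorem zero_32117 : KposV (cntV 32117) = KnegV (cntV 32117) := by
  rw [funext cntV_32117]
  decide

set_option maxHeartbeats 0 in
set_option maxRecDepth 100000 in
/-- The nineteen configuration counts of the maximal face `32214` (`K₆` minus {oa₁ ob a₁u ub}). -/
theorem cntV_32214 : ∀ i : Fin 19, cntV 32214 i = ![416, 64, 24, 174, 78, 224, 64, 186, 54, 128, 192, 36, 282, 96, 256, 72, 222, 12, 32] i := by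
  decide +kernel

/-- The maximal face `32214`: equal positive and negative monomial sums. -/
theorem zero_32214 : KposV (cntV 32214) = KnegV (cntV 32214) := by
  rw [funext cntV_32214]
  decide

end Locus

end Deg5

end Summit.Ventures.PercRepro2
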